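import Summits.HubbardSuperconductivity.HubbardSuperconductivity.Theorems.AnisotropyChordTransferFibre3OneLoop
import Summits.HubbardSuperconductivity.HubbardSuperconductivity.Theorems.AnisotropyChordTransferFibre3GradSNormClosed
import Summits.HubbardSuperconductivity.HubbardSuperconductivity.Theorems.AnisotropyChordTransferFibre3N1RowNamed
import Summits.HubbardSuperconductivity.HubbardSuperconductivity.Theorems.AnisotropyChordTransferFibre3IMS

/-!
# Route `AnisotropyChord` / H0 rotor rung, row D (KT-2a): the SYMMETRY GROUP of the low-shell terms (45 classes → 6 orbits)

The low-shell term `T(k₂,k₃) := |R̂′(k₂,k₃)|² / (V² den(k₂,k₃))` of the ground trial state `Ψ¹ = v·Π⁰` in the `K₁` fibre is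
invariant under a group of order 12 acting on the classes `(k₂,k₃)`:
* the bosonic transpositions `2 ↔ 3` : `(k₂,k₃) ↦ (k₃,k₂)` and `1 ↔ 2` : `(k₂,k₃) ↦ (K₁ − k₂ − k₃, k₃)` (`IsSymm`, in the tree:
  `isSymm_resid`), through ★ `cfgDFT_swap_of_symm`, ★ `cfgDFT_U12_of_symm`;
* the lattice reflection `y ↦ −y` (which fixes `K₁ = (1,0)`): ★ `ground_reflect` (the ground two-magnon profile is
  `y`-reflection symmetric — minimality + connectedness, as `ground_swap`), `trialK1_reflect`, `H0apply_reflect`, ★ `resid_reflect`,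
  ★ `cfgDFT_reflect_of_symm`;
* `den` is invariant under all three (`den_swap`, `den_U12`, `den_reflect`).
Hence ★★ `lowTerm_swap`, `lowTerm_U12`, `lowTerm_reflect`: the 45 low classes carry only 6 distinct values of `T` (orbits of sizes
12, 12, 6, 6, 6, 3) — the row-D cell certificate needs 6 kernel class checks instead of 45 (`…RowDOrbit`).
Prover seat `hubbard-h0-rotor-p1` g30 (route lead); helper for piece A = stmt-HubbardSuperconductivity-23918 of rung 19089
(`--supports`, helper class).  Nothing here proves superconductivity in the Hubbard model.  Tree imports only; no sorry.
-/

set_option linter.dupNamespace false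
set_option autoImplicit false

open scoped BigOperators
open Literature.Analysis.ValidatedNumerics

namespace Summit.HubbardSuperconductivity.HubbardSuperconductivity.Theorems.AnisotropyChord.Transfer.Fibre3

namespace RowD

variable (L : ℕ) [NeZero L]

/-! ## Phases under the three maps -/

/-- `phase` is invariant under the simultaneous `y`-reflection of momentum and position. [folklore] -/
theorem phase_reflect (k r : Tor L) : phase L (k.1, -k.2) (r.1, -r.2) = phase L k r := by
  rw [phase_eq_phZ, phase_eq_phZ]
  congr 1
  unfold dotZ
  ring

/-! ## The Fourier coefficient `R̂(k₂,k₃)` under the bosonic transpositions and the reflection -/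

/-- `2 ↔ 3`: a swap-symmetric `R` has `R̂(k₃,k₂) = R̂(k₂,k₃)`. [folklore] -/
theorem cfgDFT_swap_of_symm {R : Cfg L → ℂ} (hR : ∀ c : Cfg L, R (c.2, c.1) = R c) (k₂ k₃ : Tor L) :
    cfgDFT L R k₃ k₂ = cfgDFT L R k₂ k₃ := by
  unfold cfgDFT
  symm
  calc (∑ c : Cfg L, (starRingEnd ℂ) (phase L k₂ c.1 * phase L k₃ c.2) * R c)
      = ∑ c : Cfg L, (starRingEnd ℂ) (phase L k₂ (Prod.swap c).1 * phase L k₃ (Prod.swap c).2) * R (Prod.swap c) :=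
        (Fintype.sum_equiv (Equiv.prodComm (Tor L) (Tor L)) _ _ (fun c => rfl)).symm
    _ = ∑ c : Cfg L, (starRingEnd ℂ) (phase L k₃ c.1 * phase L k₂ c.2) * R c :=
        Finset.sum_congr rfl (fun c _ => by rw [Prod.swap, hR c, mul_comm (phase L k₂ c.2)])

/-- the substitution `(a, b) ↦ (−a, b − a)` of `1 ↔ 2` as an involution of the configuration space. [folklore] -/
def u12Equiv : Cfg L ≃ Cfg L where
  toFun c := (-c.1, c.2 - c.1)
  invFun c := (-c.1, c.2 - c.1)
  left_inv c := by ext <;> simp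
  right_inv c := by ext <;> simp

/-- `1 ↔ 2`: an `R` with `e^{iK·a} R(−a, b−a) = R(a,b)` has `R̂(K − k₂ − k₃, k₃) = R̂(k₂,k₃)`. [folklore] -/
theorem cfgDFT_U12_of_symm {K : Tor L} {R : Cfg L → ℂ} (hR : ∀ c : Cfg L, phase L K c.1 * R (-c.1, c.2 - c.1) = R c)
    (k₂ k₃ : Tor L) : cfgDFT L R (K - k₂ - k₃) k₃ = cfgDFT L R k₂ k₃ := by
  unfold cfgDFT
  symm
  calc (∑ c : Cfg L, (starRingEnd ℂ) (phase L k₂ c.1 * phase L k₃ c.2) * R c)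
      = ∑ c : Cfg L, (starRingEnd ℂ) (phase L k₂ (u12Equiv L c).1 * phase L k₃ (u12Equiv L c).2) * R (u12Equiv L c) :=
        (Fintype.sum_equiv (u12Equiv L) _ _ (fun c => rfl)).symm
    _ = ∑ c : Cfg L, (starRingEnd ℂ) (phase L (K - k₂ - k₃) c.1 * phase L k₃ c.2) * R c :=
        Finset.sum_congr rfl (fun c _ => ?_)
  have e1 : R (-c.1, c.2 - c.1) = phase L K (-c.1) * R c := by
    rw [← hR c, ← mul_assoc, mul_comm (phase L K (-c.1)), phase_mul_neg, one_mul]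
  show (starRingEnd ℂ) (phase L k₂ (-c.1) * phase L k₃ (c.2 - c.1)) * R (-c.1, c.2 - c.1)
      = (starRingEnd ℂ) (phase L (K - k₂ - k₃) c.1 * phase L k₃ c.2) * R c
  rw [e1, ← mul_assoc]
  congr 1
  simp only [phase_eq_phZ, conj_phZ, ← phZ_add]
  congr 1
  unfold dotZ
  simp only [Prod.fst_neg, Prod.snd_neg, Prod.fst_sub, Prod.snd_sub]
  ring

/-- the `y`-reflection `((a₁,a₂),(b₁,b₂)) ↦ ((a₁,−a₂),(b₁,−b₂))` as an involution of the configuration space. [folklore] -/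
def reflEquiv : Cfg L ≃ Cfg L where
  toFun c := ((c.1.1, -c.1.2), (c.2.1, -c.2.2))
  invFun c := ((c.1.1, -c.1.2), (c.2.1, -c.2.2))
  left_inv c := by ext <;> simp
  right_inv c := by ext <;> simp

/-- reflection: an `R` with `R(σa, σb) = R(a, b)` has `R̂(σk₂, σk₃) = R̂(k₂, k₃)`, `σ(x,y) = (x,−y)`. [folklore] -/
theorem cfgDFT_reflect_of_symm {R : Cfg L → ℂ} (hR : ∀ c : Cfg L, R ((c.1.1, -c.1.2), (c.2.1, -c.2.2)) = R c)
    (k₂ k₃ : Tor L) : cfgDFT L R (k₂.1, -k₂.2) (k₃.1, -k₃.2) = cfgDFT L R k₂ k₃ := by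
  unfold cfgDFT
  symm
  calc (∑ c : Cfg L, (starRingEnd ℂ) (phase L k₂ c.1 * phase L k₃ c.2) * R c)
      = ∑ c : Cfg L, (starRingEnd ℂ) (phase L k₂ (reflEquiv L c).1 * phase L k₃ (reflEquiv L c).2) * R (reflEquiv L c) :=
        (Fintype.sum_equiv (reflEquiv L) _ _ (fun c => rfl)).symm
    _ = ∑ c : Cfg L, (starRingEnd ℂ) (phase L (k₂.1, -k₂.2) c.1 * phase L (k₃.1, -k₃.2) c.2) * R c :=
        Finset.sum_congr rfl (fun c _ => ?_)
  show (starRingEnd ℂ) (phase L k₂ (c.1.1, -c.1.2) * phase L k₃ (c.2.1, -c.2.2)) * R ((c.1.1, -c.1.2), (c.2.1, -c.2.2))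
      = (starRingEnd ℂ) (phase L (k₂.1, -k₂.2) c.1 * phase L (k₃.1, -k₃.2) c.2) * R c
  rw [hR c]
  have h2 : phase L (k₂.1, -k₂.2) c.1 = phase L k₂ (c.1.1, -c.1.2) := by
    rw [← phase_reflect L (k₂.1, -k₂.2) c.1]; simp
  have h3 : phase L (k₃.1, -k₃.2) c.2 = phase L k₃ (c.2.1, -c.2.2) := by
    rw [← phase_reflect L (k₃.1, -k₃.2) c.2]; simp
  rw [h2, h3]

/-! ## `den` under the three maps -/

omit [NeZero L] in
/-- `den(k₃,k₂) = den(k₂,k₃)`. [folklore] -/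
theorem den_swap (T : ℝ) (k₂ k₃ : Tor L) : den L T k₃ k₂ = den L T k₂ k₃ := by
  unfold den; rw [show K1 L - k₃ - k₂ = K1 L - k₂ - k₃ by abel]; ring

omit [NeZero L] in
/-- `den(K₁ − k₂ − k₃, k₃) = den(k₂,k₃)`. [folklore] -/
theorem den_U12 (T : ℝ) (k₂ k₃ : Tor L) : den L T (K1 L - k₂ - k₃) k₃ = den L T k₂ k₃ := by
  unfold den; rw [show K1 L - (K1 L - k₂ - k₃) - k₃ = k₂ by abel]; ring

/-- `den(σk₂, σk₃) = den(k₂,k₃)`. [folklore] -/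
theorem den_reflect (T : ℝ) (k₂ k₃ : Tor L) : den L T (k₂.1, -k₂.2) (k₃.1, -k₃.2) = den L T k₂ k₃ := by
  unfold den
  have h1 : K1 L - (k₂.1, -k₂.2) - (k₃.1, -k₃.2) = ((K1 L - k₂ - k₃).1, -(K1 L - k₂ - k₃).2) := by
    unfold K1; ext <;> simp; ring
  rw [h1, epsT_reflect, epsT_reflect, epsT_reflect]

/-! ## The `y`-reflection symmetry of the ground data -/

omit [NeZero L] in
/-- `(r.1, −r.2) = (a, b) ↔ r = (a, −b)`. [folklore] -/
theorem reflect_eq_mk_iff (r : Tor L) (a b : ZMod L) : ((r.1, -r.2) : Tor L) = (a, b) ↔ r = (a, -b) := by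
  obtain ⟨x, y⟩ := r
  simp only [Prod.mk.injEq, neg_eq_iff_eq_neg]

omit [NeZero L] in
/-- `(r.1, −r.2) = 0 ↔ r = 0`. [folklore] -/
theorem reflect_eq_zero_iff (r : Tor L) : ((r.1, -r.2) : Tor L) = 0 ↔ r = 0 := by
  rw [show (0 : Tor L) = ((0 : ZMod L), (0 : ZMod L)) from rfl, reflect_eq_mk_iff, neg_zero]

omit [NeZero L] in
/-- the nearest-neighbour indicator is reflection-invariant. [folklore] -/
theorem IsNN_reflect (r : Tor L) : IsNN L (r.1, -r.2) = IsNN L r := by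
  unfold IsNN
  rw [Bool.decide_congr (reflect_eq_mk_iff L r 1 0), Bool.decide_congr (reflect_eq_mk_iff L r (-1) 0),
    Bool.decide_congr (reflect_eq_mk_iff L r 0 1), Bool.decide_congr (reflect_eq_mk_iff L r 0 (-1)), neg_zero, neg_neg]
  cases decide (r = ((1 : ZMod L), 0)) <;> cases decide (r = ((-1 : ZMod L), 0)) <;>
    cases decide (r = ((0 : ZMod L), 1)) <;> cases decide (r = ((0 : ZMod L), -1)) <;> rfl

omit [NeZero L] in
/-- `nnInd` is reflection-invariant. [folklore] -/
theorem nnInd_reflect (r : Tor L) : nnInd L (r.1, -r.2) = nnInd L r := by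
  unfold nnInd; rw [IsNN_reflect]

omit [NeZero L] in
/-- the neighbour sum of the reflected function is the reflected neighbour sum. [folklore] -/
theorem nbSum_reflect (g : Tor L → ℝ) (r : Tor L) :
    nbSum L (fun u => g (u.1, -u.2)) r = nbSum L g (r.1, -r.2) := by
  have k1 : (((r + ex L).1, -(r + ex L).2) : Tor L) = (r.1, -r.2) + ex L := by unfold ex; ext <;> simp
  have k2 : (((r + -ex L).1, -(r + -ex L).2) : Tor L) = (r.1, -r.2) + -ex L := by unfold ex; ext <;> simp
  have k3 : (((r + ey L).1, -(r + ey L).2) : Tor L) = (r.1, -r.2) + -ey L := by unfold ey; ext <;> simp; abel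
  have k4 : (((r + -ey L).1, -(r + -ey L).2) : Tor L) = (r.1, -r.2) + ey L := by unfold ey; ext <;> simp; abel
  unfold nbSum
  simp only
  rw [k1, k2, k3, k4]
  ring

/-- the reflected profile solves the same two-magnon equation. [folklore] -/
theorem twoMagnon_eq_nbSum_reflect {Δ lam2 : ℝ} {f : Tor L → ℝ} (hf : IsTwoMagnon L Δ lam2 f) (r : Tor L) (hr : r ≠ 0) :
    (4 - Δ * nnInd L r) * f (r.1, -r.2) - nbSum L (fun u => f (u.1, -u.2)) r = lam2 * f (r.1, -r.2) := by
  rw [nbSum_reflect, ← nnInd_reflect]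
  exact twoMagnon_eq_nbSum L hf (r.1, -r.2) (by rw [Ne, reflect_eq_zero_iff]; exact hr)

/-- ★ **the ground two-magnon profile is `y`-reflection symmetric:** `f (x, −y) = f (x, y)` (`L ≥ 2`) — the reflected profile
solves the same equation, so `h = f − f∘σ` does, `|h|` is a minimiser vanishing at `x̂ = (1,0)` (a fixed point of `σ`), and zeros
of a nonnegative minimiser propagate over the punctured torus. [folklore] -/
theorem ground_reflect (hL : 2 ≤ L) {Δ lam2 : ℝ} {f : Tor L → ℝ} (hf : IsGroundTwoMagnon L Δ lam2 f) (r : Tor L) :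
    f (r.1, -r.2) = f r := by
  classical
  obtain ⟨htm, _, hmin⟩ := hf
  have h0 : f 0 = 0 := htm.1
  have h00 : f (((0 : Tor L)).1, -((0 : Tor L)).2) = 0 := by
    rw [show ((((0 : Tor L)).1, -((0 : Tor L)).2) : Tor L) = 0 from by ext <;> simp]; exact h0
  set h : Tor L → ℝ := fun u => f u - f (u.1, -u.2) with hh
  have hz : h 0 = 0 := by simp only [hh]; rw [h00, h0]; ring
  have heqh : ∀ u : Tor L, u ≠ 0 → (4 - Δ * nnInd L u) * h u - nbSum L h u = lam2 * h u := by
    intro u hu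
    have e1 := twoMagnon_eq_nbSum L htm u hu
    have e2 := twoMagnon_eq_nbSum_reflect L htm u hu
    have hnb : nbSum L h u = nbSum L f u - nbSum L (fun w => f (w.1, -w.2)) u := by
      simp only [hh]; unfold nbSum; ring
    rw [hnb]; simp only [hh]
    linear_combination e1 - e2
  have hQh := qf_of_eq L hz heqh
  set g : Tor L → ℝ := fun u => |h u| with hg
  have hg0 : ∀ u, 0 ≤ g u := fun u => abs_nonneg _
  have hgz : g 0 = 0 := by simp only [hg]; rw [hz, abs_zero]
  have hQg : twoMagnonQF L Δ g = lam2 * ∑ u : Tor L, g u ^ 2 := by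
    have hle := qf_abs_le L Δ h
    have hge := hmin g hgz
    have hsq : ∑ u : Tor L, g u ^ 2 = ∑ u : Tor L, h u ^ 2 := Finset.sum_congr rfl fun u _ => sq_abs (h u)
    rw [hsq] at hge ⊢
    have hle' : twoMagnonQF L Δ g ≤ twoMagnonQF L Δ h := hle
    linarith
  have hnb : ∀ u : Tor L, u ≠ 0 → g u = 0 → nbSum L g u = 0 :=
    fun u hu hgu => nbSum_eq_zero_of_min L hg0 hmin hQg hgz hu hgu
  have hx : ∀ u : Tor L, u ≠ 0 → g u = 0 → u + ex L ≠ 0 → g (u + ex L) = 0 := by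
    intro u hu hgu _
    have e := hnb u hu hgu
    unfold nbSum at e
    have := hg0 (u + ex L); have := hg0 (u + -ex L); have := hg0 (u + ey L); have := hg0 (u + -ey L)
    linarith
  have hy : ∀ u : Tor L, u ≠ 0 → g u = 0 → u + ey L ≠ 0 → g (u + ey L) = 0 := by
    intro u hu hgu _
    have e := hnb u hu hgu
    unfold nbSum at e
    have := hg0 (u + ex L); have := hg0 (u + -ex L); have := hg0 (u + ey L); have := hg0 (u + -ey L)
    linarith
  -- the axis point `x̂ = (1, 0)` is a fixed point of the reflection, hence a zero of `g`
  have h1 : (1 : ZMod L) ≠ 0 := by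
    haveI : Fact (1 < L) := ⟨by omega⟩
    exact one_ne_zero
  have h10 : ex L ≠ 0 := fun e => h1 (congrArg Prod.fst e)
  have hg10 : g (ex L) = 0 := by
    simp only [hg, hh]
    rw [show (((ex L).1, -(ex L).2) : Tor L) = ex L from by unfold ex; ext <;> simp, sub_self, abs_zero]
  by_cases hr : r = 0
  · rw [hr, h00, h0]
  · have key := torus_connect L hL (fun u => g u = 0) hx hy h10 hr hg10
    have : |f r - f (r.1, -r.2)| = 0 := key
    rw [abs_eq_zero, sub_eq_zero] at this
    exact this.symm

/-- `K₁ = (1,0)` phases are reflection-invariant: `e^{iK₁·σr} = e^{iK₁·r}`. [folklore] -/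
theorem phase_K1_reflect (r : Tor L) : phase L (K1 L) (r.1, -r.2) = phase L (K1 L) r := by
  have h := phase_reflect L (K1 L) r
  rwa [show (((K1 L).1, -(K1 L).2) : Tor L) = K1 L from by unfold K1; ext <;> simp] at h

/-- the trial state is reflection-invariant: `Ψ¹(σa, σb) = Ψ¹(a, b)`. [folklore] -/
theorem trialK1_reflect (hL : 2 ≤ L) {Δ lam2 : ℝ} {f : Tor L → ℝ} (hf : IsGroundTwoMagnon L Δ lam2 f) (c : Cfg L) :
    trialK1 L f ((c.1.1, -c.1.2), (c.2.1, -c.2.2)) = trialK1 L f c := by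
  unfold trialK1 vfun prodState
  have hd : (((c.2.1, -c.2.2) : Tor L) - (c.1.1, -c.1.2)) = ((c.2 - c.1).1, -(c.2 - c.1).2) := by ext <;> simp; ring
  simp only [phase_K1_reflect, hd, ground_reflect L hL hf]

omit [NeZero L] in
/-- `W` is reflection-invariant. [folklore] -/
theorem Wcount_reflect (c : Cfg L) : Wcount L ((c.1.1, -c.1.2), (c.2.1, -c.2.2)) = Wcount L c := by
  unfold Wcount
  have hd : (((c.2.1, -c.2.2) : Tor L) - (c.1.1, -c.1.2)) = ((c.2 - c.1).1, -(c.2 - c.1).2) := by ext <;> simp; ring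
  simp only [hd, IsNN_reflect]

omit [NeZero L] in
/-- the hard core is reflection-invariant. [folklore] -/
theorem InD_reflect (c : Cfg L) : InD L ((c.1.1, -c.1.2), (c.2.1, -c.2.2)) = InD L c := by
  unfold InD
  have h1 : (((c.1.1, -c.1.2) : Tor L) = 0) ↔ (c.1 = 0) := reflect_eq_zero_iff L c.1
  have h2 : (((c.2.1, -c.2.2) : Tor L) = 0) ↔ (c.2 = 0) := reflect_eq_zero_iff L c.2
  have h3 : (((c.1.1, -c.1.2) : Tor L) = (c.2.1, -c.2.2)) ↔ (c.1 = c.2) := by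
    constructor
    · intro h
      have h' := (reflect_eq_mk_iff L c.1 c.2.1 (-c.2.2)).mp h
      rw [h']; simp
    · intro h; rw [h]
  simp only [Bool.decide_congr h1, Bool.decide_congr h2, Bool.decide_congr h3]

/-- `H₀^{K₁}` commutes with the reflection (the `y`-hops are exchanged; their `K₁`-phases are both `1`). [folklore] -/
theorem H0apply_reflect (F : Cfg L → ℂ) (c : Cfg L) :
    H0apply L (K1 L) (fun d => F ((d.1.1, -d.1.2), (d.2.1, -d.2.2))) c
      = H0apply L (K1 L) F ((c.1.1, -c.1.2), (c.2.1, -c.2.2)) := by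
  simp only [H0apply_four, hopT, (phase_K1_ey L).1, (phase_K1_ey L).2, one_mul]
  have a1 : (((c.1 + ex L).1, -(c.1 + ex L).2) : Tor L) = (c.1.1, -c.1.2) + ex L := by unfold ex; ext <;> simp
  have a2 : (((c.1 + -ex L).1, -(c.1 + -ex L).2) : Tor L) = (c.1.1, -c.1.2) + -ex L := by unfold ex; ext <;> simp
  have a3 : (((c.1 + ey L).1, -(c.1 + ey L).2) : Tor L) = (c.1.1, -c.1.2) + -ey L := by unfold ey; ext <;> simp; abel
  have a4 : (((c.1 + -ey L).1, -(c.1 + -ey L).2) : Tor L) = (c.1.1, -c.1.2) + ey L := by unfold ey; ext <;> simp; abel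
  have b1 : (((c.2 + ex L).1, -(c.2 + ex L).2) : Tor L) = (c.2.1, -c.2.2) + ex L := by unfold ex; ext <;> simp
  have b2 : (((c.2 + -ex L).1, -(c.2 + -ex L).2) : Tor L) = (c.2.1, -c.2.2) + -ex L := by unfold ex; ext <;> simp
  have b3 : (((c.2 + ey L).1, -(c.2 + ey L).2) : Tor L) = (c.2.1, -c.2.2) + -ey L := by unfold ey; ext <;> simp; abel
  have b4 : (((c.2 + -ey L).1, -(c.2 + -ey L).2) : Tor L) = (c.2.1, -c.2.2) + ey L := by unfold ey; ext <;> simp; abel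
  have d1 : (((c.1 - ex L).1, -(c.1 - ex L).2) : Tor L) = (c.1.1, -c.1.2) - ex L := by unfold ex; ext <;> simp
  have d2 : (((c.1 - -ex L).1, -(c.1 - -ex L).2) : Tor L) = (c.1.1, -c.1.2) - -ex L := by unfold ex; ext <;> simp
  have d3 : (((c.1 - ey L).1, -(c.1 - ey L).2) : Tor L) = (c.1.1, -c.1.2) - -ey L := by unfold ey; ext <;> simp; abel
  have d4 : (((c.1 - -ey L).1, -(c.1 - -ey L).2) : Tor L) = (c.1.1, -c.1.2) - ey L := by unfold ey; ext <;> simp; abel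
  have e1 : (((c.2 - ex L).1, -(c.2 - ex L).2) : Tor L) = (c.2.1, -c.2.2) - ex L := by unfold ex; ext <;> simp
  have e2 : (((c.2 - -ex L).1, -(c.2 - -ex L).2) : Tor L) = (c.2.1, -c.2.2) - -ex L := by unfold ex; ext <;> simp
  have e3 : (((c.2 - ey L).1, -(c.2 - ey L).2) : Tor L) = (c.2.1, -c.2.2) - -ey L := by unfold ey; ext <;> simp; abel
  have e4 : (((c.2 - -ey L).1, -(c.2 - -ey L).2) : Tor L) = (c.2.1, -c.2.2) - ey L := by unfold ey; ext <;> simp; abel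
  simp only [a1, a2, a3, a4, b1, b2, b3, b4, d1, d2, d3, d4, e1, e2, e3, e4]
  ring

/-- ★ the residual `R′ = (H − ε₁ − T⁺)Ψ¹` (off the hard core) is reflection-invariant. [folklore] -/
theorem resid_reflect (hL : 2 ≤ L) {Δ lam2 : ℝ} {f : Tor L → ℝ} (hf : IsGroundTwoMagnon L Δ lam2 f) (c : Cfg L) :
    resid L Δ f ((c.1.1, -c.1.2), (c.2.1, -c.2.2)) = resid L Δ f c := by
  have hΨ : (fun d : Cfg L => trialK1 L f ((d.1.1, -d.1.2), (d.2.1, -d.2.2))) = trialK1 L f :=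
    funext fun d => trialK1_reflect L hL hf d
  have hH : Happly L (K1 L) Δ (trialK1 L f) ((c.1.1, -c.1.2), (c.2.1, -c.2.2)) = Happly L (K1 L) Δ (trialK1 L f) c := by
    unfold Happly
    rw [← H0apply_reflect, hΨ, Wcount_reflect, trialK1_reflect L hL hf]
  unfold resid residual
  rw [InD_reflect, hH, trialK1_reflect L hL hf]

/-! ## The low-shell term under the three maps -/

/-- the low-shell term `T(k₂,k₃) = |R̂′(k₂,k₃)|²/(V²·den(k₂,k₃))`. [folklore] -/
noncomputable def lowTerm (Δ : ℝ) (f : Tor L → ℝ) (k₂ k₃ : Tor L) : ℝ :=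
  Complex.normSq (cfgDFT L (resid L Δ f) k₂ k₃) / (((L : ℝ) ^ 2) ^ 2 * den L (Tplus L Δ f) k₂ k₃)

/-- ★★ `T(k₃,k₂) = T(k₂,k₃)`. [folklore] -/
theorem lowTerm_swap {Δ lam2 : ℝ} {f : Tor L → ℝ} (hf : IsGroundTwoMagnon L Δ lam2 f) (k₂ k₃ : Tor L) :
    lowTerm L Δ f k₃ k₂ = lowTerm L Δ f k₂ k₃ := by
  unfold lowTerm
  rw [cfgDFT_swap_of_symm L (isSymm_resid L hf).1, den_swap]

/-- ★★ `T(K₁ − k₂ − k₃, k₃) = T(k₂,k₃)`. [folklore] -/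
theorem lowTerm_U12 {Δ lam2 : ℝ} {f : Tor L → ℝ} (hf : IsGroundTwoMagnon L Δ lam2 f) (k₂ k₃ : Tor L) :
    lowTerm L Δ f (K1 L - k₂ - k₃) k₃ = lowTerm L Δ f k₂ k₃ := by
  unfold lowTerm
  rw [cfgDFT_U12_of_symm L (isSymm_resid L hf).2, den_U12]

/-- ★★ `T(σk₂, σk₃) = T(k₂,k₃)` (`L ≥ 2`). [folklore] -/
theorem lowTerm_reflect (hL : 2 ≤ L) {Δ lam2 : ℝ} {f : Tor L → ℝ} (hf : IsGroundTwoMagnon L Δ lam2 f) (k₂ k₃ : Tor L) :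
    lowTerm L Δ f (k₂.1, -k₂.2) (k₃.1, -k₃.2) = lowTerm L Δ f k₂ k₃ := by
  unfold lowTerm
  rw [cfgDFT_reflect_of_symm L (resid_reflect L hL hf), den_reflect]

end RowD

end Summit.HubbardSuperconductivity.HubbardSuperconductivity.Theorems.AnisotropyChord.Transfer.Fibre3
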